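import Literature.AnabelianGeometry.EtaleTheta.Discharge.Sec5TowerOfConnectedTemperoid
import Literature.AnabelianGeometry.EtaleTheta.Discharge.Sec5RootChainModel
import Literature.AnabelianGeometry.EtaleTheta.TemperedFrobenioidLaws

/-!
# [EtTh] §5 tower over the GENUINE connected base `B^temp(Π^tp_X)⁰` FROM THE BASE-LEVEL LAWS: the compatible root family
# (Rmk. 4.3.2) at `mkOfConnectedTemperoid` with `hS` discharged, and the tower `ofConnectedTemperoidFamily` assembled with NO
# root-family / transition input (Rmk. 4.3.2 pp. 318–319, Prop. 4.2 (iii) p. 314, §5 pp. 330–331 / PDF pp. 92–93, 88, 104–105)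

Mochizuki, *The étale theta function and its Frobenioid-theoretic manifestations*, Publ. RIMS **45** (2009), Rmk. 4.3.2
pp. 318–319 (PDF pp. 92–93) «… by allowing `N` to vary, we obtain a compatible system of roots of the fraction-pair `(s′, s″)`»;
§5 p. 330 (PDF p. 104) «by considering compatible systems as in Remark 4.3.2»; Def. 4.1 (ii) p. 313 (PDF p. 87) («natural
surjective outer homomorphism `Π^tp_X ↠ Aut_D(A)`»)
[cite: MochizukiEtTh2009, Rmk 4.3.2 p.318–319 (PDF pp.92–93); §5 p.330–331 (PDF pp.104–105); Def 4.1 (ii) p.313 (PDF p.87)].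

abc-iut cell, layer L2, PROOF-ONLY consumer companion (0 `def`s; seat abc-iut-w6-d053 gen 4, row «TOWER-FROM-LAWS AT THE GENUINE
BASE», GO abc-iut-w5-d134 g4 STATUS 11:02:29Z) of abc-iut-w5-d134's `Discharge/Sec5RootChainModel.lean` (p439666,
`BiKummerSetting.exists_compatibleRootFamily_mkOfModelCanonical`) and abc-iut-L2-t4's `Discharge/Sec5TowerOfConnectedTemperoid.lean`
(`ThetaFrobenioidTower.ofConnectedTemperoidFamily`, «inputs left: the Rmk. 4.3.2 transitions»).  Sequel of this seat's
`Discharge/Sec5RootTransitionsOfConnectedTemperoid.lean` (p439673: transitions from a GIVEN covering family).  Nothing landed is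
edited or restated; every named input is consumed BY NAME:
* `BiKummerSetting.exists_compatibleRootFamily_mkOfConnectedTemperoid` — p439666 read at abc-iut-L2-t4's §4 setting over
  `B^temp(Π^tp_X)⁰`: the Def. 4.1 (ii) naturality law `hS` is the THEOREM `mkOfConnectedTemperoid_galoisSurj_natural`, so the
  compatible root FAMILY `R N` (`N ≥ 1`, each `N`-domain in a skeleton through `A_⊙`, `μ_{l·N}`-saturated, Def. 4.1 (iii)(a) at
  `l·N`) with the Rmk. 4.3.2 transitions for all `N ∣ N′` exists modulo the base-level laws `Φ` divisorial (`hΦd`), `hDSpull`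
  ([FrdI] Prop. 4.1 (iii)), `hR` (ERRATUM-E2 root law, G-w4d044-3), `hEdiv` ([FrdII] Rmk. 2.2.1 family form, G-w5d134g4-1) alone;
* `BiKummerSetting.exists_compatibleRootFamily_transitions_mkOfConnectedTemperoid` — the same with the transitions CHOSEN as the
  nine function families `α`, `β`, `comm_sCap`, `comm_sCup`, `isIsometry_α`, `degFr_α`, `isIsometry_β`, `degFr_β`, `baseFrob_α`
  in EXACTLY the binder types of `ofConnectedTemperoidFamily` (`sec5Stub` shapes; `Φ` divisorial := `h.isDivisorial`);
* `ThetaFrobenioidTower.exists_rootFamily_tower_ofConnectedTemperoid` — **the §5 tower over `B^temp(Π^tp_X)⁰` from the laws**: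
  from `h` ([FrdI] Thm. 5.2 hypotheses of the §5 data), `hDSpull`, `hR`, `hEdiv`, an `l`-th root datum `Rl` of `Θ̈`'s pair with
  `A_l` in a skeleton through `A_⊙` (`hskl`) and `f_l` fixed by `H_{A_l}` (`hfixl`; for `A_l = A_⊙` a theorem,
  abc-iut-w5-d134's `isFixedByHA_Aodot_mkOfModelCanonical`): a root family `R` with print's «`J̈_{l·N}`» clauses at every level
  such that for ANY constants, ANY divisor invariances `hinvc`/`hinvp` at the levels, and any §2 tower `𝒯`, there is a
  `ThetaFrobenioidTower` over `mkOfConnectedTemperoid` whose level `M ∈ E` IS `ThetaFrobenioid.ofConnectedTemperoidData` over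
  `𝒯.level M` and whose `StrvSection` holds at every `N ≥ 1` (`atLevel_ofConnectedTemperoidFamily_eq`,
  `strvSection_atLevel_ofConnectedTemperoidFamily` by name);
* `ThetaFrobenioidTower.exists_rootFamily_tower_ofConnectedTemperoid_of_thetaDivisor` — with the divisor invariances supplied by
  abc-iut-L2-t4's `hinvc_family_ofConnectedTemperoid` / `hinvp_family_ofConnectedTemperoid` from the `Π^tp_X`-stability `hθ`/`hθ'`
  of `Div(s′_l)`, `Div(s″_l)` (Prop. 4.3 (i) proof p. 317; §5 p. 330) and per-object constants `κ A : K′^× →* O^×(A^birat)`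
  (abc-iut-w4-d008's terminal-object shape `B(t)^× ∘ c₀`, `Sec5ConstEmbOfTerminal.lean`, is one): the tower with NO root-family,
  NO transition and NO per-level divisor-invariance input.
HONEST FRAMING: kernel-checked consequences of the named base-level laws for data so typed; the laws `hDSpull`, `hR`, `hEdiv` and
the parameter class `TemperedFrobenioid T₀ (ConnectedPart (BTemp X.Pi)) VD` are NOT shown to hold / be inhabited here; nothing
asserts that such data exist for an actual curve; typed ≠ proved for the laws; no side is taken on [IUTchIII] Cor. 3.12.
-/

noncomputable section

namespace Literature.AnabelianGeometry.EtaleTheta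

open CategoryTheory Opposite Literature.AlgebraicGeometry.Frobenioids Literature.AnabelianGeometry.SemiGraphs
  Literature.AnabelianGeometry.SemiGraphs.GaloisObjects

universe u₀ v₀ w

/-! ## The compatible root family at `mkOfConnectedTemperoid`: `hS` discharged -/
namespace BiKummerSetting

section ConnectedTemperoid

variable {K : Type u₀} [Field K] (X : SemiGraphs.TemperedArithmeticGroup.{u₀} K) {D₀ : Type u₀} [Category.{v₀} D₀]
  {V : FrdIMonoidStub.{w}} {T₀ : RealifiedDivisorMonoids (D₀ := D₀) V}
  {VD : FrdICatStub.{u₀ + 1, u₀, w} (ConnectedPart (BTemp X.Pi))}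
  (tf : TemperedFrobenioid T₀ (ConnectedPart (BTemp X.Pi)) VD) (hZ : tf.monoidType = MonoidType.Z)
  (hP : ∀ A : (ConnectedPart (BTemp X.Pi))ᵒᵖ, IsPerfect (tf.Φ.carrier A))
  (NH : Subgroup (Field.absoluteGaloisGroup K) → tf.category → ℕ+ → Prop)
  (A₀ : tf.category) (hA₀ : PreFrobenioid.IsFrobeniusTrivial tf.toElem A₀) (hA₀' : SemiGraphs.IsGaloisObj A₀.base.obj)

/-- **[EtTh] Rmk. 4.3.2 «compatible system of roots» over `B^temp(Π^tp_X)⁰`, from the base-level laws** — abc-iut-w5-d134's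
`exists_compatibleRootFamily_mkOfModelCanonical` (p439666) at abc-iut-L2-t4's `mkOfConnectedTemperoid`, with the Def. 4.1 (ii)
naturality law `hS` DISCHARGED by `mkOfConnectedTemperoid_galoisSurj_natural`: a family `R N` (`N ≥ 1`) of `N`-th root data of a
right fraction-pair `P` of an `H_A`-fixed `f ∈ O^×(A^birat)` (`A` Frobenius-trivial, Galois base, in a skeleton through `A_⊙`), each
`N`-domain in a skeleton through `A_⊙`, `μ_{l·N}`-saturated, with Def. 4.1 (iii)(a) at `l·N`, and the Rmk. 4.3.2 transitions for
all `N ∣ N′`.  Laws: `Φ` divisorial, `hDSpull`, `hR`, `hEdiv`.  [cite: MochizukiEtTh2009, Rmk 4.3.2 p.318–319 (PDF pp.92–93); Def 4.1 (ii) p.313 (PDF p.87)] -/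
theorem exists_compatibleRootFamily_mkOfConnectedTemperoid
    (hΦd : Objectwise (fun M _ => IsDivisorial M) tf.divisorMonoid)
    (hDSpull : ∀ {A A' : ConnectedPart (BTemp X.Pi)} (e : A' ⟶ A) {a b : tf.Φ.carrier (op A)},
      (∀ x : tf.Φ.carrier (op A), x ∣ a → x ∣ b → x = 1) →
        ∀ y : tf.Φ.carrier (op A'), y ∣ pull tf.divisorMonoid e a → y ∣ pull tf.divisorMonoid e b → y = 1)
    (hR : ∀ (N : ℕ+) (A : ConnectedPart (BTemp X.Pi)), SemiGraphs.IsGaloisObj A.obj → ∀ f : tf.ratFnFunctor.obj (op A),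
      ∃ (A' : ConnectedPart (BTemp X.Pi)) (_ : SemiGraphs.IsGaloisObj A'.obj) (b : A' ⟶ A) (g : tf.ratFnFunctor.obj (op A')),
        g ^ (N : ℕ) = pull tf.ratFnFunctor b f)
    (hEdiv : ∀ (M : ℕ+) (A' : tf.category), PreFrobenioid.IsFrobeniusTrivial tf.toElem A' →
      SemiGraphs.IsGaloisObj A'.base.obj →
        ∃ (A'' : tf.category) (ψ : A'' ⟶ A'), PreFrobenioid.IsPullbackMorphism tf.toElem ψ ∧
          SemiGraphs.IsGaloisObj A''.base.obj ∧ tf.IsMuSaturated A'' M ∧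
            ∀ N : ℕ+, (N : ℕ) ∣ (M : ℕ) → NH (mkOfConnectedTemperoid X tf hZ hP NH A₀ hA₀ hA₀').HodotBsFld A'' N)
    {A B : tf.category} (hAft : PreFrobenioid.IsFrobeniusTrivial tf.toElem A) (hAG : SemiGraphs.IsGaloisObj A.base.obj)
    (hskA : Nonempty (A.base ≅ A₀.base) → A = A₀)
    {f : tf.biratUnitsModel A} (hfix : (mkOfConnectedTemperoid X tf hZ hP NH A₀ hA₀ hA₀').IsFixedByHA A hAG f)
    (P : (mkOfConnectedTemperoid X tf hZ hP NH A₀ hA₀ hA₀').FractionPair f B) (lv : ℕ+) :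
    ∃ R : ∀ N : ℕ+, (mkOfConnectedTemperoid X tf hZ hP NH A₀ hA₀ hA₀').NthRoot f P N (fun {_} φ x => tf.pullFracModel φ x),
      (∀ N : ℕ+, (Nonempty ((R N).AN.base ≅ A₀.base) → (R N).AN = A₀) ∧ tf.IsMuSaturated (R N).AN (lv * N) ∧
        ∃ (A₁ A₂ : tf.category) (s₁ : A₁ ⟶ (R N).AN) (s₂ : A₁ ⟶ A₂),
          (mkOfConnectedTemperoid X tf hZ hP NH A₀ hA₀ hA₀').IsPreStep s₁ ∧
            (mkOfConnectedTemperoid X tf hZ hP NH A₀ hA₀ hA₀').IsPreStep s₂ ∧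
              (mkOfConnectedTemperoid X tf hZ hP NH A₀ hA₀ hA₀').IsFrobeniusTrivial A₂ ∧
                (mkOfConnectedTemperoid X tf hZ hP NH A₀ hA₀ hA₀').IsNHSaturatedBsFld
                  (mkOfConnectedTemperoid X tf hZ hP NH A₀ hA₀ hA₀').HodotBsFld A₂ (lv * N)) ∧
      ∀ (N N' : ℕ+), (N : ℕ) ∣ (N' : ℕ) → ∃ (α : (R N').AN ⟶ (R N).AN) (β : (R N').BN ⟶ (R N).BN),
        (R N').pair.num ≫ β = α ≫ (R N).pair.num ∧ (R N').pair.den ≫ β = α ≫ (R N).pair.den ∧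
          (mkOfConnectedTemperoid X tf hZ hP NH A₀ hA₀ hA₀').IsIsometry α ∧
            ((mkOfConnectedTemperoid X tf hZ hP NH A₀ hA₀ hA₀').degFr α : ℕ) * N = N' ∧
              (mkOfConnectedTemperoid X tf hZ hP NH A₀ hA₀ hA₀').IsIsometry β ∧
                ((mkOfConnectedTemperoid X tf hZ hP NH A₀ hA₀ hA₀').degFr β : ℕ) * N = N' ∧
                  (mkOfConnectedTemperoid X tf hZ hP NH A₀ hA₀ hA₀').IsOfBaseFrobeniusType α :=
  exists_compatibleRootFamily_mkOfModelCanonical X tf hZ hP _ _ _ NH A₀ hA₀ hA₀' hΦd hDSpull hR hEdiv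
    (mkOfConnectedTemperoid_galoisSurj_natural X tf hZ hP NH A₀ hA₀ hA₀') hAft hAG hskA hfix P lv

/-- **The compatible root family over `B^temp(Π^tp_X)⁰` with the transitions CHOSEN as function families** in exactly the binder
types of abc-iut-L2-t4's `ThetaFrobenioidTower.ofConnectedTemperoidFamily` (`α`, `β`, `comm_sCap`, `comm_sCup`, `isIsometry_α`,
`degFr_α`, `isIsometry_β`, `degFr_β`, `baseFrob_α`; `(S.sec5Stub h).pre.IsIsometry/degFr = S.IsIsometry/degFr` definitionally), from
the [FrdI] Thm. 5.2 hypotheses `h` (`Φ` divisorial := `h.isDivisorial`) and the laws `hDSpull`, `hR`, `hEdiv`.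
[cite: MochizukiEtTh2009, Rmk 4.3.2 p.318–319 (PDF pp.92–93)] -/
theorem exists_compatibleRootFamily_transitions_mkOfConnectedTemperoid
    (h : ModelFrobenioid.Hypotheses tf.divisorMonoid tf.ratFnFunctor)
    (hDSpull : ∀ {A A' : ConnectedPart (BTemp X.Pi)} (e : A' ⟶ A) {a b : tf.Φ.carrier (op A)},
      (∀ x : tf.Φ.carrier (op A), x ∣ a → x ∣ b → x = 1) →
        ∀ y : tf.Φ.carrier (op A'), y ∣ pull tf.divisorMonoid e a → y ∣ pull tf.divisorMonoid e b → y = 1)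
    (hR : ∀ (N : ℕ+) (A : ConnectedPart (BTemp X.Pi)), SemiGraphs.IsGaloisObj A.obj → ∀ f : tf.ratFnFunctor.obj (op A),
      ∃ (A' : ConnectedPart (BTemp X.Pi)) (_ : SemiGraphs.IsGaloisObj A'.obj) (b : A' ⟶ A) (g : tf.ratFnFunctor.obj (op A')),
        g ^ (N : ℕ) = pull tf.ratFnFunctor b f)
    (hEdiv : ∀ (M : ℕ+) (A' : tf.category), PreFrobenioid.IsFrobeniusTrivial tf.toElem A' →
      SemiGraphs.IsGaloisObj A'.base.obj →
        ∃ (A'' : tf.category) (ψ : A'' ⟶ A'), PreFrobenioid.IsPullbackMorphism tf.toElem ψ ∧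
          SemiGraphs.IsGaloisObj A''.base.obj ∧ tf.IsMuSaturated A'' M ∧
            ∀ N : ℕ+, (N : ℕ) ∣ (M : ℕ) → NH (mkOfConnectedTemperoid X tf hZ hP NH A₀ hA₀ hA₀').HodotBsFld A'' N)
    {A B : tf.category} (hAft : PreFrobenioid.IsFrobeniusTrivial tf.toElem A) (hAG : SemiGraphs.IsGaloisObj A.base.obj)
    (hskA : Nonempty (A.base ≅ A₀.base) → A = A₀)
    {f : tf.biratUnitsModel A} (hfix : (mkOfConnectedTemperoid X tf hZ hP NH A₀ hA₀ hA₀').IsFixedByHA A hAG f)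
    (P : (mkOfConnectedTemperoid X tf hZ hP NH A₀ hA₀ hA₀').FractionPair f B) (lv : ℕ+) :
    ∃ (R : ∀ N : ℕ+, (mkOfConnectedTemperoid X tf hZ hP NH A₀ hA₀ hA₀').NthRoot f P N (fun {_} φ x => tf.pullFracModel φ x))
      (α : ∀ {N N' : ℕ+}, (N : ℕ) ∣ N' → ((R N').AN ⟶ (R N).AN))
      (β : ∀ {N N' : ℕ+}, (N : ℕ) ∣ N' → ((R N').BN ⟶ (R N).BN)),
      (∀ N : ℕ+, (Nonempty ((R N).AN.base ≅ A₀.base) → (R N).AN = A₀) ∧ tf.IsMuSaturated (R N).AN (lv * N) ∧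
        ∃ (A₁ A₂ : tf.category) (s₁ : A₁ ⟶ (R N).AN) (s₂ : A₁ ⟶ A₂),
          (mkOfConnectedTemperoid X tf hZ hP NH A₀ hA₀ hA₀').IsPreStep s₁ ∧
            (mkOfConnectedTemperoid X tf hZ hP NH A₀ hA₀ hA₀').IsPreStep s₂ ∧
              (mkOfConnectedTemperoid X tf hZ hP NH A₀ hA₀ hA₀').IsFrobeniusTrivial A₂ ∧
                (mkOfConnectedTemperoid X tf hZ hP NH A₀ hA₀ hA₀').IsNHSaturatedBsFld
                  (mkOfConnectedTemperoid X tf hZ hP NH A₀ hA₀ hA₀').HodotBsFld A₂ (lv * N)) ∧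
      (∀ {N N' : ℕ+} (hd : (N : ℕ) ∣ N'), (R N').pair.num ≫ β hd = α hd ≫ (R N).pair.num) ∧
        (∀ {N N' : ℕ+} (hd : (N : ℕ) ∣ N'), (R N').pair.den ≫ β hd = α hd ≫ (R N).pair.den) ∧
          (∀ {N N' : ℕ+} (hd : (N : ℕ) ∣ N'),
            ((mkOfConnectedTemperoid X tf hZ hP NH A₀ hA₀ hA₀').sec5Stub h).pre.IsIsometry (α hd)) ∧
            (∀ {N N' : ℕ+} (hd : (N : ℕ) ∣ N'),
              (((mkOfConnectedTemperoid X tf hZ hP NH A₀ hA₀ hA₀').sec5Stub h).pre.degFr (α hd) : ℕ) * N = N') ∧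
              (∀ {N N' : ℕ+} (hd : (N : ℕ) ∣ N'),
                ((mkOfConnectedTemperoid X tf hZ hP NH A₀ hA₀ hA₀').sec5Stub h).pre.IsIsometry (β hd)) ∧
                (∀ {N N' : ℕ+} (hd : (N : ℕ) ∣ N'),
                  (((mkOfConnectedTemperoid X tf hZ hP NH A₀ hA₀ hA₀').sec5Stub h).pre.degFr (β hd) : ℕ) * N = N') ∧
                  (∀ {N N' : ℕ+} (hd : (N : ℕ) ∣ N'),
                    (mkOfConnectedTemperoid X tf hZ hP NH A₀ hA₀ hA₀').IsOfBaseFrobeniusType (α hd)) := by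
  obtain ⟨R, hcl, htr⟩ := exists_compatibleRootFamily_mkOfConnectedTemperoid X tf hZ hP NH A₀ hA₀ hA₀' h.isDivisorial hDSpull
    hR hEdiv hAft hAG hskA hfix P lv
  choose α β hcn hcd hiα hdα hiβ hdβ hbf using htr
  exact ⟨R, fun {N N'} hd => α N N' hd, fun {N N'} hd => β N N' hd, hcl, fun hd => hcn _ _ hd, fun hd => hcd _ _ hd,
    fun hd => hiα _ _ hd, fun hd => hdα _ _ hd, fun hd => hiβ _ _ hd, fun hd => hdβ _ _ hd, fun hd => hbf _ _ hd⟩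

end ConnectedTemperoid

end BiKummerSetting

/-! ## The §5 tower over `B^temp(Π^tp_X)⁰` from the laws -/
namespace ThetaFrobenioidTower

variable {K : Type u₀} [Field K] {X : SemiGraphs.TemperedArithmeticGroup.{u₀} K} {D₀ : Type u₀} [Category.{v₀} D₀]
  {V : FrdIMonoidStub.{w}} {T₀ : RealifiedDivisorMonoids (D₀ := D₀) V}
  {VD : FrdICatStub.{u₀ + 1, u₀, w} (ConnectedPart (BTemp X.Pi))}
  {tf : TemperedFrobenioid T₀ (ConnectedPart (BTemp X.Pi)) VD} {hZ : tf.monoidType = MonoidType.Z}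
  {hP : ∀ A : (ConnectedPart (BTemp X.Pi))ᵒᵖ, IsPerfect (tf.Φ.carrier A)}
  {NH : Subgroup (Field.absoluteGaloisGroup K) → tf.category → ℕ+ → Prop} {A₀ : tf.category}
  {hA₀ : PreFrobenioid.IsFrobeniusTrivial tf.toElem A₀} {hA₀' : SemiGraphs.IsGaloisObj A₀.base.obj}
  {lv : ℕ+} {θ : tf.biratUnitsModel A₀} {Bl : tf.category}
  {Pl : (BiKummerSetting.mkOfConnectedTemperoid X tf hZ hP NH A₀ hA₀ hA₀').FractionPair θ Bl}
  (h : ModelFrobenioid.Hypotheses tf.divisorMonoid tf.ratFnFunctor)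
  (Rl : (BiKummerSetting.mkOfConnectedTemperoid X tf hZ hP NH A₀ hA₀ hA₀').NthRoot θ Pl lv
    (fun {_} φ x => tf.pullFracModel φ x))
  (hDSpull : ∀ {A A' : ConnectedPart (BTemp X.Pi)} (e : A' ⟶ A) {a b : tf.Φ.carrier (op A)},
    (∀ x : tf.Φ.carrier (op A), x ∣ a → x ∣ b → x = 1) →
      ∀ y : tf.Φ.carrier (op A'), y ∣ pull tf.divisorMonoid e a → y ∣ pull tf.divisorMonoid e b → y = 1)
  (hR : ∀ (N : ℕ+) (A : ConnectedPart (BTemp X.Pi)), SemiGraphs.IsGaloisObj A.obj → ∀ f : tf.ratFnFunctor.obj (op A),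
    ∃ (A' : ConnectedPart (BTemp X.Pi)) (_ : SemiGraphs.IsGaloisObj A'.obj) (b : A' ⟶ A) (g : tf.ratFnFunctor.obj (op A')),
      g ^ (N : ℕ) = pull tf.ratFnFunctor b f)
  (hEdiv : ∀ (M : ℕ+) (A' : tf.category), PreFrobenioid.IsFrobeniusTrivial tf.toElem A' →
    SemiGraphs.IsGaloisObj A'.base.obj →
      ∃ (A'' : tf.category) (ψ : A'' ⟶ A'), PreFrobenioid.IsPullbackMorphism tf.toElem ψ ∧
        SemiGraphs.IsGaloisObj A''.base.obj ∧ tf.IsMuSaturated A'' M ∧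
          ∀ N : ℕ+, (N : ℕ) ∣ (M : ℕ) → NH (BiKummerSetting.mkOfConnectedTemperoid X tf hZ hP NH A₀ hA₀ hA₀').HodotBsFld A'' N)
  (hskl : Nonempty (Rl.AN.base ≅ A₀.base) → Rl.AN = A₀)
  (hfixl : (BiKummerSetting.mkOfConnectedTemperoid X tf hZ hP NH A₀ hA₀ hA₀').IsFixedByHA Rl.AN Rl.αData.isGalois Rl.root)
  {E : Set ℕ+} (𝒯 : ThetaEnvTower.{max u₀ w} E) (Q : FrobenioidTheta.ThetaSubquotientStub.{w} (ConnectedPart (BTemp X.Pi)))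
  (odd_l : Odd (lv : ℕ)) (ιX : 𝒯.PiX ≃ₜ* X.Pi) (K' : Type w) [Field K']

/-- **The tower with prescribed levels, packaged** (abc-iut-L2-t4's `ofConnectedTemperoidFamily` + `atLevel_ofConnectedTemperoidFamily_eq`
+ `strvSection_atLevel_ofConnectedTemperoidFamily`, by name): for root data `R N`, constants, divisor invariances and ANY Rmk. 4.3.2
transition block there is a `ThetaFrobenioidTower` over `mkOfConnectedTemperoid` whose level `M ∈ E` is
`ThetaFrobenioid.ofConnectedTemperoidData` over `𝒯.level M`, with `StrvSection` at every level.
[cite: MochizukiEtTh2009, §5 p.330–331 (PDF pp.104–105); Rmk 4.3.2 p.318–319 (PDF pp.92–93)] -/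
theorem exists_tower_of_transitions_ofConnectedTemperoid
    (R : ∀ N : ℕ+, (BiKummerSetting.mkOfConnectedTemperoid X tf hZ hP NH A₀ hA₀ hA₀').NthRoot Rl.root Rl.pair N
      (fun {_} φ x => tf.pullFracModel φ x))
    (constEmb : ∀ N : ℕ+, K'ˣ →* tf.biratUnitsModel (R N).BN)
    (constEmb_injective : ∀ N : ℕ+, Function.Injective (constEmb N))
    (hinvc : ∀ (N : ℕ+) (g : Aut (R N).AN.base),
      pull tf.divisorMonoid g.hom (ModelFrobenioid.div (R N).pair.num) = ModelFrobenioid.div (R N).pair.num)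
    (hinvp : ∀ (N : ℕ+) (y : 𝒯.PiX), y ∈ 𝒯.PiYdd →
      pull tf.divisorMonoid ((BiKummerSetting.mkOfConnectedTemperoid X tf hZ hP NH A₀ hA₀ hA₀').galoisSurj (R N).AN.base
        (R N).αData.isGalois (ιX y)).hom (ModelFrobenioid.div (R N).pair.den) = ModelFrobenioid.div (R N).pair.den)
    (α : ∀ {N N' : ℕ+}, (N : ℕ) ∣ N' → ((R N').AN ⟶ (R N).AN))
    (β : ∀ {N N' : ℕ+}, (N : ℕ) ∣ N' → ((R N').BN ⟶ (R N).BN))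
    (comm_sCap : ∀ {N N' : ℕ+} (hd : (N : ℕ) ∣ N'), (R N').pair.num ≫ β hd = α hd ≫ (R N).pair.num)
    (comm_sCup : ∀ {N N' : ℕ+} (hd : (N : ℕ) ∣ N'), (R N').pair.den ≫ β hd = α hd ≫ (R N).pair.den)
    (isIsometry_α : ∀ {N N' : ℕ+} (hd : (N : ℕ) ∣ N'),
      ((BiKummerSetting.mkOfConnectedTemperoid X tf hZ hP NH A₀ hA₀ hA₀').sec5Stub h).pre.IsIsometry (α hd))
    (degFr_α : ∀ {N N' : ℕ+} (hd : (N : ℕ) ∣ N'),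
      (((BiKummerSetting.mkOfConnectedTemperoid X tf hZ hP NH A₀ hA₀ hA₀').sec5Stub h).pre.degFr (α hd) : ℕ) * N = N')
    (isIsometry_β : ∀ {N N' : ℕ+} (hd : (N : ℕ) ∣ N'),
      ((BiKummerSetting.mkOfConnectedTemperoid X tf hZ hP NH A₀ hA₀ hA₀').sec5Stub h).pre.IsIsometry (β hd))
    (degFr_β : ∀ {N N' : ℕ+} (hd : (N : ℕ) ∣ N'),
      (((BiKummerSetting.mkOfConnectedTemperoid X tf hZ hP NH A₀ hA₀ hA₀').sec5Stub h).pre.degFr (β hd) : ℕ) * N = N')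
    (baseFrob_α : ∀ {N N' : ℕ+} (hd : (N : ℕ) ∣ N'),
      (BiKummerSetting.mkOfConnectedTemperoid X tf hZ hP NH A₀ hA₀ hA₀').IsOfBaseFrobeniusType (α hd)) :
    ∃ 𝔗 : ThetaFrobenioidTower.{w} (BiKummerSetting.mkOfConnectedTemperoid X tf hZ hP NH A₀ hA₀ hA₀').C
        (ConnectedPart (BTemp X.Pi)),
      (∀ M : E, 𝔗.atLevel M =
          ThetaFrobenioid.ofConnectedTemperoidData (pullFrac := fun {_ _} φ x => tf.pullFracModel φ x) (T := 𝒯.level M) h Q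
            odd_l (R M) ιX K' (constEmb M) (constEmb_injective M) (hinvc M) (hinvp M)) ∧
        ∀ N : ℕ+, (𝔗.atLevel N).StrvSection :=
  ⟨ofConnectedTemperoidFamily (pullFrac := fun {_ _} φ x => tf.pullFracModel φ x) h Q odd_l R ιX K' constEmb
      constEmb_injective hinvc hinvp α β comm_sCap comm_sCup isIsometry_α degFr_α isIsometry_β degFr_β baseFrob_α,
    fun M => atLevel_ofConnectedTemperoidFamily_eq (pullFrac := fun {_ _} φ x => tf.pullFracModel φ x) h Q odd_l R ιX K'
      constEmb constEmb_injective hinvc hinvp α β comm_sCap comm_sCup isIsometry_α degFr_α isIsometry_β degFr_β baseFrob_α M,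
    fun N => strvSection_atLevel_ofConnectedTemperoidFamily (pullFrac := fun {_ _} φ x => tf.pullFracModel φ x) h Q odd_l R
      ιX K' constEmb constEmb_injective hinvc hinvp α β comm_sCap comm_sCup isIsometry_α degFr_α isIsometry_β degFr_β
      baseFrob_α N⟩

include hDSpull hR hEdiv hskl hfixl in
/-- **The [EtTh] §5 tower over the GENUINE connected base `B^temp(Π^tp_X)⁰`, from the base-level laws** (§5 p. 330 «by considering
compatible systems as in Remark 4.3.2»): from `h`, `hDSpull`, `hR`, `hEdiv`, an `l`-th root datum `Rl` with `A_l` in a skeleton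
through `A_⊙` and `f_l` fixed by `H_{A_l}` — a root family `R N` (`N ≥ 1`; skeleton clause, `μ_{l·N}`-saturation, Def. 4.1 (iii)(a)
at `l·N` at every level) such that for ANY constants `K′^× ↪ O^×(B_N^birat)` and ANY divisor invariances `hinvc`/`hinvp` at the
levels there is a `ThetaFrobenioidTower` over `mkOfConnectedTemperoid` whose level `M ∈ E` IS the §5 data
`ThetaFrobenioid.ofConnectedTemperoidData` over `𝒯.level M` and whose section property `StrvSection` holds at every `N ≥ 1`
(abc-iut-L2-t4's `ofConnectedTemperoidFamily`, `atLevel_ofConnectedTemperoidFamily_eq`, `strvSection_atLevel_ofConnectedTemperoidFamily`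
fed with the chosen transitions).  [cite: MochizukiEtTh2009, §5 p.330–331 (PDF pp.104–105); Rmk 4.3.2 p.318–319 (PDF pp.92–93)] -/
theorem exists_rootFamily_tower_ofConnectedTemperoid :
    ∃ R : ∀ N : ℕ+, (BiKummerSetting.mkOfConnectedTemperoid X tf hZ hP NH A₀ hA₀ hA₀').NthRoot Rl.root Rl.pair N
        (fun {_} φ x => tf.pullFracModel φ x),
      (∀ N : ℕ+, (Nonempty ((R N).AN.base ≅ A₀.base) → (R N).AN = A₀) ∧ tf.IsMuSaturated (R N).AN (lv * N) ∧
        ∃ (A₁ A₂ : tf.category) (s₁ : A₁ ⟶ (R N).AN) (s₂ : A₁ ⟶ A₂),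
          (BiKummerSetting.mkOfConnectedTemperoid X tf hZ hP NH A₀ hA₀ hA₀').IsPreStep s₁ ∧
            (BiKummerSetting.mkOfConnectedTemperoid X tf hZ hP NH A₀ hA₀ hA₀').IsPreStep s₂ ∧
              (BiKummerSetting.mkOfConnectedTemperoid X tf hZ hP NH A₀ hA₀ hA₀').IsFrobeniusTrivial A₂ ∧
                (BiKummerSetting.mkOfConnectedTemperoid X tf hZ hP NH A₀ hA₀ hA₀').IsNHSaturatedBsFld
                  (BiKummerSetting.mkOfConnectedTemperoid X tf hZ hP NH A₀ hA₀ hA₀').HodotBsFld A₂ (lv * N)) ∧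
      ∀ (constEmb : ∀ N : ℕ+, K'ˣ →* tf.biratUnitsModel (R N).BN)
        (constEmb_injective : ∀ N : ℕ+, Function.Injective (constEmb N))
        (hinvc : ∀ (N : ℕ+) (g : Aut (R N).AN.base),
          pull tf.divisorMonoid g.hom (ModelFrobenioid.div (R N).pair.num) = ModelFrobenioid.div (R N).pair.num)
        (hinvp : ∀ (N : ℕ+) (y : 𝒯.PiX), y ∈ 𝒯.PiYdd →
          pull tf.divisorMonoid ((BiKummerSetting.mkOfConnectedTemperoid X tf hZ hP NH A₀ hA₀ hA₀').galoisSurj (R N).AN.base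
            (R N).αData.isGalois (ιX y)).hom (ModelFrobenioid.div (R N).pair.den) = ModelFrobenioid.div (R N).pair.den),
        ∃ 𝔗 : ThetaFrobenioidTower.{w} (BiKummerSetting.mkOfConnectedTemperoid X tf hZ hP NH A₀ hA₀ hA₀').C
            (ConnectedPart (BTemp X.Pi)),
          (∀ M : E, 𝔗.atLevel M =
              ThetaFrobenioid.ofConnectedTemperoidData (pullFrac := fun {_ _} φ x => tf.pullFracModel φ x) (T := 𝒯.level M) h Q
                odd_l (R M) ιX K' (constEmb M) (constEmb_injective M) (hinvc M) (hinvp M)) ∧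
            ∀ N : ℕ+, (𝔗.atLevel N).StrvSection :=
  -- term-mode `Exists.elim` chain: an `obtain`/`rcases` pattern here computes `casesOn` motives over this (large) statement
  -- and exceeds the default heartbeat budget; projections of the conjunction are cheap.
  (BiKummerSetting.exists_compatibleRootFamily_transitions_mkOfConnectedTemperoid X tf hZ hP NH A₀ hA₀ hA₀' h hDSpull hR hEdiv
      Rl.αData.isFrobeniusTrivial Rl.αData.isGalois hskl hfixl Rl.pair lv).elim fun R hR' => hR'.elim fun α hα =>
    hα.elim fun β hall =>
      ⟨R, hall.1, fun constEmb constEmb_injective hinvc hinvp =>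
        exists_tower_of_transitions_ofConnectedTemperoid h Rl 𝒯 Q odd_l ιX K' R constEmb constEmb_injective hinvc hinvp α β
          hall.2.1 hall.2.2.1 hall.2.2.2.1 hall.2.2.2.2.1 hall.2.2.2.2.2.1 hall.2.2.2.2.2.2.1 hall.2.2.2.2.2.2.2⟩

include hDSpull hR hEdiv hskl hfixl in
/-- **The §5 tower over `B^temp(Π^tp_X)⁰` with NO root-family, NO transition and NO per-level divisor-invariance input**: as in
`exists_rootFamily_tower_ofConnectedTemperoid`, with the constants given per object (`κ A : K′^× →* O^×(A^birat)`, injective) and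
the divisor invariances at every level supplied by abc-iut-L2-t4's `hinvc_family_ofConnectedTemperoid` /
`hinvp_family_ofConnectedTemperoid` from the `Π^tp_X`-stability `hθ`, `hθ'` of `Div(s′_l)`, `Div(s″_l)` (Prop. 4.3 (i) proof
p. 317; §5 p. 330).  [cite: MochizukiEtTh2009, §5 p.330–331 (PDF pp.104–105); Prop 4.3 (i) p.317 (PDF p.91)] -/
theorem exists_rootFamily_tower_ofConnectedTemperoid_of_thetaDivisor
    (κ : ∀ A : tf.category, K'ˣ →* tf.biratUnitsModel A) (κinj : ∀ A : tf.category, Function.Injective (κ A))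
    (hθ : ∀ x : X.Pi, pull tf.divisorMonoid ((BiKummerSetting.mkOfConnectedTemperoid X tf hZ hP NH A₀ hA₀ hA₀').galoisSurj
      A₀.base hA₀' x).hom (ModelFrobenioid.div Pl.num) = ModelFrobenioid.div Pl.num)
    (hθ' : ∀ x : X.Pi, pull tf.divisorMonoid ((BiKummerSetting.mkOfConnectedTemperoid X tf hZ hP NH A₀ hA₀ hA₀').galoisSurj
      A₀.base hA₀' x).hom (ModelFrobenioid.div Pl.den) = ModelFrobenioid.div Pl.den) :
    ∃ (R : ∀ N : ℕ+, (BiKummerSetting.mkOfConnectedTemperoid X tf hZ hP NH A₀ hA₀ hA₀').NthRoot Rl.root Rl.pair N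
        (fun {_} φ x => tf.pullFracModel φ x))
      (hinvc : ∀ (N : ℕ+) (g : Aut (R N).AN.base),
        pull tf.divisorMonoid g.hom (ModelFrobenioid.div (R N).pair.num) = ModelFrobenioid.div (R N).pair.num)
      (hinvp : ∀ (N : ℕ+) (y : 𝒯.PiX), y ∈ 𝒯.PiYdd →
        pull tf.divisorMonoid ((BiKummerSetting.mkOfConnectedTemperoid X tf hZ hP NH A₀ hA₀ hA₀').galoisSurj (R N).AN.base
          (R N).αData.isGalois (ιX y)).hom (ModelFrobenioid.div (R N).pair.den) = ModelFrobenioid.div (R N).pair.den)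
      (𝔗 : ThetaFrobenioidTower.{w} (BiKummerSetting.mkOfConnectedTemperoid X tf hZ hP NH A₀ hA₀ hA₀').C
        (ConnectedPart (BTemp X.Pi))),
      (∀ N : ℕ+, (Nonempty ((R N).AN.base ≅ A₀.base) → (R N).AN = A₀) ∧ tf.IsMuSaturated (R N).AN (lv * N) ∧
        ∃ (A₁ A₂ : tf.category) (s₁ : A₁ ⟶ (R N).AN) (s₂ : A₁ ⟶ A₂),
          (BiKummerSetting.mkOfConnectedTemperoid X tf hZ hP NH A₀ hA₀ hA₀').IsPreStep s₁ ∧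
            (BiKummerSetting.mkOfConnectedTemperoid X tf hZ hP NH A₀ hA₀ hA₀').IsPreStep s₂ ∧
              (BiKummerSetting.mkOfConnectedTemperoid X tf hZ hP NH A₀ hA₀ hA₀').IsFrobeniusTrivial A₂ ∧
                (BiKummerSetting.mkOfConnectedTemperoid X tf hZ hP NH A₀ hA₀ hA₀').IsNHSaturatedBsFld
                  (BiKummerSetting.mkOfConnectedTemperoid X tf hZ hP NH A₀ hA₀ hA₀').HodotBsFld A₂ (lv * N)) ∧
      (∀ M : E, 𝔗.atLevel M =
          ThetaFrobenioid.ofConnectedTemperoidData (pullFrac := fun {_ _} φ x => tf.pullFracModel φ x) (T := 𝒯.level M) h Q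
            odd_l (R M) ιX K' (κ (R M).BN) (κinj (R M).BN) (hinvc M) (hinvp M)) ∧
        ∀ N : ℕ+, (𝔗.atLevel N).StrvSection :=
  (exists_rootFamily_tower_ofConnectedTemperoid h Rl hDSpull hR hEdiv hskl hfixl 𝒯 Q odd_l ιX K').elim fun R hR' =>
    (hR'.2 (fun N => κ (R N).BN) (fun N => κinj (R N).BN)
        (hinvc_family_ofConnectedTemperoid (pullFrac := fun {_ _} φ x => tf.pullFracModel φ x) h R hθ)
        (hinvp_family_ofConnectedTemperoid (pullFrac := fun {_ _} φ x => tf.pullFracModel φ x) h R ιX hθ')).elim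
      fun 𝔗 h𝔗 =>
        ⟨R, hinvc_family_ofConnectedTemperoid (pullFrac := fun {_ _} φ x => tf.pullFracModel φ x) h R hθ,
          hinvp_family_ofConnectedTemperoid (pullFrac := fun {_ _} φ x => tf.pullFracModel φ x) h R ιX hθ', 𝔗, hR'.1,
          h𝔗.1, h𝔗.2⟩


/-! ### v2 (append-only): the E2 root law RE-KEYED on the named predicate `TemperedFrobenioid.BaseRootLaw` (census A10) -/

include hDSpull hEdiv hskl hfixl in
/-- **The §5 tower over `B^temp(Π^tp_X)⁰` from the laws, the ERRATUM-E2 root law `hR` REPLACED by abc-iut-L2-t3's NAMED predicate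
`tf.BaseRootLaw (fun A => IsGaloisObj A.obj)`** (`TemperedFrobenioidLaws.lean`, census A10 = abc-iut-w4-d044's `hR₀`, G-w4d044-3)
plus the injectivity `hTF` of `N`-th powers in `(Φ^{ℝ-log})^gp`, via `TemperedFrobenioid.rootLaw_of_baseRootLaw'` (`Φ` perfect, `hP`).
Over the canonical [FrdI] vocabularies `hTF` is a theorem: take `hTF := fun A _ hN =>
T₀.pow_injective_ΦR_gp_treeVocab (op (tf.base.obj A)) hN` (abc-iut-w4-d044, `Sec4Prop42SubRootLawTreeVocab`) resp.
`…_treeVocabWeak` (abc-iut-w6-d037).  Laws left: `hDSpull`, `BaseRootLaw`, `hEdiv` (G-w5d134g4-1).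
[cite: MochizukiEtTh2009, §5 p.330 (PDF p.104); Prop 4.2 (iii) p.315 (PDF p.89); Rmk 4.3.2 p.318–319 (PDF pp.92–93)] -/
theorem exists_rootFamily_tower_ofConnectedTemperoid_of_baseRootLaw
    (hTF : ∀ (A : ConnectedPart (BTemp X.Pi)) (N : ℕ), 0 < N →
      Function.Injective fun x : Algebra.GrothendieckGroup (T₀.ΦR.obj (op (tf.base.obj A))) => x ^ N)
    (hR₀ : tf.BaseRootLaw fun A : ConnectedPart (BTemp X.Pi) => SemiGraphs.IsGaloisObj A.obj) :
    ∃ R : ∀ N : ℕ+, (BiKummerSetting.mkOfConnectedTemperoid X tf hZ hP NH A₀ hA₀ hA₀').NthRoot Rl.root Rl.pair N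
        (fun {_} φ x => tf.pullFracModel φ x),
      (∀ N : ℕ+, (Nonempty ((R N).AN.base ≅ A₀.base) → (R N).AN = A₀) ∧ tf.IsMuSaturated (R N).AN (lv * N) ∧
        ∃ (A₁ A₂ : tf.category) (s₁ : A₁ ⟶ (R N).AN) (s₂ : A₁ ⟶ A₂),
          (BiKummerSetting.mkOfConnectedTemperoid X tf hZ hP NH A₀ hA₀ hA₀').IsPreStep s₁ ∧
            (BiKummerSetting.mkOfConnectedTemperoid X tf hZ hP NH A₀ hA₀ hA₀').IsPreStep s₂ ∧
              (BiKummerSetting.mkOfConnectedTemperoid X tf hZ hP NH A₀ hA₀ hA₀').IsFrobeniusTrivial A₂ ∧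
                (BiKummerSetting.mkOfConnectedTemperoid X tf hZ hP NH A₀ hA₀ hA₀').IsNHSaturatedBsFld
                  (BiKummerSetting.mkOfConnectedTemperoid X tf hZ hP NH A₀ hA₀ hA₀').HodotBsFld A₂ (lv * N)) ∧
      ∀ (constEmb : ∀ N : ℕ+, K'ˣ →* tf.biratUnitsModel (R N).BN)
        (constEmb_injective : ∀ N : ℕ+, Function.Injective (constEmb N))
        (hinvc : ∀ (N : ℕ+) (g : Aut (R N).AN.base),
          pull tf.divisorMonoid g.hom (ModelFrobenioid.div (R N).pair.num) = ModelFrobenioid.div (R N).pair.num)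
        (hinvp : ∀ (N : ℕ+) (y : 𝒯.PiX), y ∈ 𝒯.PiYdd →
          pull tf.divisorMonoid ((BiKummerSetting.mkOfConnectedTemperoid X tf hZ hP NH A₀ hA₀ hA₀').galoisSurj (R N).AN.base
            (R N).αData.isGalois (ιX y)).hom (ModelFrobenioid.div (R N).pair.den) = ModelFrobenioid.div (R N).pair.den),
        ∃ 𝔗 : ThetaFrobenioidTower.{w} (BiKummerSetting.mkOfConnectedTemperoid X tf hZ hP NH A₀ hA₀ hA₀').C
            (ConnectedPart (BTemp X.Pi)),
          (∀ M : E, 𝔗.atLevel M =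
              ThetaFrobenioid.ofConnectedTemperoidData (pullFrac := fun {_ _} φ x => tf.pullFracModel φ x) (T := 𝒯.level M) h Q
                odd_l (R M) ιX K' (constEmb M) (constEmb_injective M) (hinvc M) (hinvp M)) ∧
            ∀ N : ℕ+, (𝔗.atLevel N).StrvSection :=
  exists_rootFamily_tower_ofConnectedTemperoid h Rl hDSpull
    (fun N A hA f => tf.rootLaw_of_baseRootLaw' (fun A : ConnectedPart (BTemp X.Pi) => SemiGraphs.IsGaloisObj A.obj) hP hTF
      hR₀ N A hA f)
    hEdiv hskl hfixl 𝒯 Q odd_l ιX K'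

end ThetaFrobenioidTower

end Literature.AnabelianGeometry.EtaleTheta

end
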